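import Literature.Geometry.Lorentzian.KerrDeSitterHiddenSymmetryKernel
import Literature.Geometry.Lorentzian.KerrDeSitterSurfaceGravities
import HarnessLib

/-!
# Venture KdS — ROUTE W: Casals–Teixeira da Costa's Proposition-3.8 fact (H3) reduced, in the
# kernel, to four named analytic lemmas via Euler's integral transformation

HONEST FRAMING (venture `Summits/Ventures/KdS`, cell `pub-kds`; MONDAY-REBALANCE item 2 decision
object, NOT a result about Kerr–de Sitter): this file PROVES
`prop38_of_routeW : Transfer → EulerRL → GaugeGlue → SwappedEnergyVanishing → SpinFlip →`
`  CasalsTeixeiraDaCosta2022_partialModeStabilityProp38`,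
i.e. it reduces the cell's cited fact H3 (Casals–Teixeira da Costa 2022, Prop. 3.8 / Cor. 3.9 /
Thm 3.10 Step 2, `Literature/Geometry/Lorentzian/KerrDeSitterThresholdRays.lean`) to FIVE named
`Prop`s, each an ordinary statement of real analysis with its intended proof route and size written
in its docstring. Nothing here discharges H3; the five `Prop`s are hypotheses. What IS kernel-checked
is (a) that these five statements, exactly as typed, imply H3 verbatim, and (b) — in the Literature
files this one imports — the complete ALGEBRA of the route: the Euler/Kazakov–Slavyanov kernel
identity (`GeneralHeun.euler_kernel_identity`, [Takemura2017] Prop. 1.2), the fact that Takemura's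
parameter map with `η = α = 1+s+2η₀` IS the hidden symmetry `m₂ ↔ m₃` including the accessory
parameter (`euler_swap_*`), `(3.11) =` Heun normal form (`sqcdCoeff_eq_normalForm`) and
`(3.25) = (3.11)|_{m₂↔m₃}` (`ctdcTilde_eq_sqcd_swap`).

THE ROUTE (cell memo `theory/ROUTE-W-KERNEL.md`): a radial mode `R` (tree predicates
`IsRadialTeukolskySolution`, `IsIngoingAtEventHorizon`, `IsOutgoingAtCosmoHorizon`) is moved to the
Euler gauge of CTdC's `z`-variable on `(1, z₂)` (`Transfer`); the ONE-SIDED Euler /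
Riemann–Liouville transform from the event horizon `z = 1` with kernel `(z−w)^{−(1−s−2η₀)}`
(regularised by `z`-derivatives when `Re ≥ 1`) produces a solution of the `m₂ ↔ m₃`-swapped
equation with the swapped boundary branches and is injective (`EulerRL`, a statement about GENERAL
Heun equations); back to CTdC's normal form (3.25)/(3.26) (`GaugeGlue`, general masses); there the
energy identity of CTdC's Step 2 forces vanishing (`SwappedEnergyVanishing`, LIT-1's file); for spins
`s ≥ 1` the integrability condition at `z = 1` (`Re(2η₁ − s) > −1`) is first restored by passing to
the spin `−s` companion (`SpinFlip`, the Teukolsky–Starobinsky/Umetsu leg; vacuous for the cell's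
`s = −2, 0`). No continued fractions, no hypergeometric expansions, no contour integrals.

Sizes (Lean lines, estimates): `Transfer` ≈ 400–500 (twin of `KerrDeSitterHeunEquivalence` under
CTdC's Möbius map; exact CAS check kit j165967); `EulerRL` ≈ 800–1200 (its algebraic core is landed:
`euler_kernel_identity`, `euler_tau_identity`; remaining: differentiation under `∫₀¹`, two endpoint
limits, Beta-integral branch at `1`, smoothness across `z₂`, injectivity, induction on the
regularisation order — CAS checks kit j166563/w3-tau-reg); `GaugeGlue` ≈ 200–300 (calculus with
`z^{γ/2}(z−1)^{δ/2}(z₂−z)^{ε/2}` + `sqcdCoeff_eq_normalForm`); `SwappedEnergyVanishing` ≈ 700–900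
(LIT-1 g5, in progress, `KerrDeSitterHiddenSymmetryEnergy.lean`); `SpinFlip` ≈ 300–400 (Umetsu's
`HeunDerivative` + exponent bookkeeping; not needed for `s ≤ 1/2`).

References: Casals–Teixeira da Costa, Commun. Math. Phys. 394 (2022) 797–832
[CasalsTeixeiradacosta2022] §3.3–3.4; K. Takemura, J. Math. Soc. Japan 69 (2017) 849–891
[Takemura2017] Prop. 1.2.
-/

noncomputable section

open Set Complex

namespace Summit.Ventures.KdS

namespace RouteW

open Literature.Analysis.ODE Literature.Analysis.ODE.GeneralHeun
open Literature.Geometry.Lorentzian Literature.Geometry.Lorentzian.KerrDeSitter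

/-! ### Data carriers -/

/-- **Euler-gauge Heun mode data on `(1, z₂)`.** `v` is a classical solution of Umetsu's Heun
equation `lead·v″ + mid_{γδε}·v′ + (αβ·+q)·v = 0` on `(1,z₂)` (`a_H = z₂`), it is the Frobenius
branch `(w−1)^ρ·h(w)` at `w = 1` with `h` smooth on a two-sided neighbourhood (principal power of the
positive real `w − 1`), and it agrees near `z₂⁻` with a function smooth across `z₂` (the analytic
branch). This is the shape in which the tree states "ingoing"/"outgoing" (`IsIngoingAtEventHorizon`,
`IsOutgoingAtCosmoHorizon`). -/
def HeunModeData (z₂ : ℝ) (α β γ δ ε q ρ : ℂ) (v : ℝ → ℂ) : Prop :=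
  GeneralHeun.IsSolutionOn (z₂ : ℂ) α β γ δ ε q (Ioo 1 z₂) v ∧
  (∃ e : ℝ, 0 < e ∧ ∃ h : ℝ → ℂ, ContDiffOn ℝ ((⊤ : ℕ∞) : WithTop ℕ∞) h (Ioo (1 - e) (1 + e)) ∧
      ∀ w ∈ Ioo 1 (1 + e), v w = ((w - 1 : ℝ) : ℂ) ^ ρ * h w) ∧
  (∃ e : ℝ, 0 < e ∧ ∃ g : ℝ → ℂ, ContDiffOn ℝ ((⊤ : ℕ∞) : WithTop ℕ∞) g (Ioo (z₂ - e) (z₂ + e)) ∧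
      ∀ w ∈ Ioo (z₂ - e) z₂, v w = g w)

/-- **Normal-form mode data on `(1, z₂)`** (CTdC's shape (3.11)/(3.25) with boundary conditions
(3.16)/(3.26)): `R` is a classical solution of `z(z−1)(z−z₂)·R″ + C(z)·R = 0` on `(1,z₂)`,
`R = (z−1)^{e₁}·h` near `1⁺` and `R = (z₂−z)^{e₂}·g` near `z₂⁻` with `h`, `g` smooth on two-sided
neighbourhoods (positive real bases). -/
def NormalFormModeData (z₂ : ℝ) (C : ℝ → ℂ) (e₁ e₂ : ℂ) (R : ℝ → ℂ) : Prop :=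
  (∃ R₁ R₂ : ℝ → ℂ, ∀ z ∈ Ioo 1 z₂, HasDerivAt R (R₁ z) z ∧ HasDerivAt R₁ (R₂ z) z ∧
      GeneralHeun.lead (z₂ : ℂ) z * R₂ z + C z * R z = 0) ∧
  (∃ e : ℝ, 0 < e ∧ ∃ h : ℝ → ℂ, ContDiffOn ℝ ((⊤ : ℕ∞) : WithTop ℕ∞) h (Ioo (1 - e) (1 + e)) ∧
      ∀ z ∈ Ioo 1 (1 + e), R z = ((z - 1 : ℝ) : ℂ) ^ e₁ * h z) ∧
  (∃ e : ℝ, 0 < e ∧ ∃ g : ℝ → ℂ, ContDiffOn ℝ ((⊤ : ℕ∞) : WithTop ℕ∞) g (Ioo (z₂ - e) (z₂ + e)) ∧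
      ∀ z ∈ Ioo (z₂ - e) z₂, R z = ((z₂ - z : ℝ) : ℂ) ^ e₂ * g z)

/-- Changing the coefficient function on `(1,z₂)` does not change normal-form mode data. -/
theorem NormalFormModeData.congr {z₂ : ℝ} {C C' : ℝ → ℂ} {e₁ e₂ : ℂ} {R : ℝ → ℂ}
    (h : NormalFormModeData z₂ C e₁ e₂ R) (hC : ∀ z ∈ Ioo 1 z₂, C z = C' z) :
    NormalFormModeData z₂ C' e₁ e₂ R := by
  obtain ⟨⟨R₁, R₂, hode⟩, h1, h2⟩ := h
  refine ⟨⟨R₁, R₂, fun z hz => ?_⟩, h1, h2⟩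
  obtain ⟨ha, hb, hc⟩ := hode z hz
  exact ⟨ha, hb, by rw [← hC z hz]; exact hc⟩

/-! ### Kerr–de Sitter abbreviations (CTdC (3.10), (3.14), (3.15)) -/

/-- CTdC's `z₂` (3.14) of the geometry `(M,a,Λ)`: roots `r₀ = rMinus`, `r₁ = rPlus`, `r₂ = rCosmo`
(`r₃ = rNeg = −(r₀+r₁+r₂)`). -/
def zTwo (M a Λ : ℝ) : ℝ := ctdcZ₂ (rMinus M a Λ) (rPlus M a Λ) (rCosmo M a Λ)

/-- The `λ̄`-block `LT = L²(λ̄ − 2Ξ²amω + a²Ξ²ω²)/((r₂−r₃)(r₁−r₀))`, `L² = 3/Λ`, of (3.15)/(3.25)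
(STU separation constant `λ` converted by `lambdaBar`). -/
def ltBlock (M a Λ s : ℝ) (ω : ℂ) (m : ℝ) (lam : ℂ) : ℂ :=
  ((3 / Λ : ℝ) : ℂ) *
      (lambdaBar a Λ s ω m lam - 2 * (xi a Λ : ℂ) ^ 2 * (a : ℂ) * (m : ℂ) * ω +
        (a : ℂ) ^ 2 * (xi a Λ : ℂ) ^ 2 * ω ^ 2) /
    ((((rCosmo M a Λ - rNeg M a Λ) * (rPlus M a Λ - rMinus M a Λ)) : ℝ) : ℂ)

/-- Mass `m₁ = s − η₁ − η₀` of the geometry/frequency. -/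
def mass₁ (M a Λ s : ℝ) (ω : ℂ) (m : ℝ) : ℂ := sqcdM₁ (s : ℂ) (etaCauchy M a Λ ω m) (etaEvent M a Λ ω m)

/-- Mass `m₂ = η₀ − η₁`. -/
def mass₂ (M a Λ : ℝ) (ω : ℂ) (m : ℝ) : ℂ := sqcdM₂ (etaCauchy M a Λ ω m) (etaEvent M a Λ ω m)

/-- Mass `m₃ = −s − η₁ − η₀`. -/
def mass₃ (M a Λ s : ℝ) (ω : ℂ) (m : ℝ) : ℂ := sqcdM₃ (s : ℂ) (etaCauchy M a Λ ω m) (etaEvent M a Λ ω m)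

/-- Mass `m₄ = η₀ + η₁ + 2η₂`. -/
def mass₄ (M a Λ : ℝ) (ω : ℂ) (m : ℝ) : ℂ :=
  sqcdM₄ (etaCauchy M a Λ ω m) (etaEvent M a Λ ω m) (etaCosmo M a Λ ω m)

/-- CTdC's `E` of (3.15): `E = (E z₂)/z₂` with `E z₂ = ctdcEz₂ …`. -/
def bigE (M a Λ s : ℝ) (ω : ℂ) (m : ℝ) (lam : ℂ) : ℂ :=
  ctdcEz₂ (s : ℂ) (etaCauchy M a Λ ω m) (etaEvent M a Λ ω m) (etaCosmo M a Λ ω m)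
      (ltBlock M a Λ s ω m lam) (zTwo M a Λ : ℂ) (rMinus M a Λ) (rPlus M a Λ) (rCosmo M a Λ) /
    (zTwo M a Λ : ℂ)

/-- The `y`-coefficient of the swapped equation (3.25) for the geometry/frequency, as a function of
`z`. -/
def tildeCoeff (M a Λ s : ℝ) (ω : ℂ) (m : ℝ) (lam : ℂ) (z : ℝ) : ℂ :=
  ctdcTildeCoeff (s : ℂ) (etaCauchy M a Λ ω m) (etaEvent M a Λ ω m) (etaCosmo M a Λ ω m)
    (ltBlock M a Λ s ω m lam) (zTwo M a Λ : ℂ) (rMinus M a Λ) (rPlus M a Λ) (rCosmo M a Λ) z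

/-- The STU separation constant of the spin-`−s` companion: `λ' = λ − 2s(1−α)`, characterised by
`lambdaBar a Λ (−s) ω m λ' = lambdaBar a Λ s ω m λ` (CTdC's (ii): "the radial ODE … where `s` is
replaced by `−s`", same `λ̄`). -/
def lamFlip (a Λ s : ℝ) (lam : ℂ) : ℂ := lam - ((2 * s * (1 - alpha a Λ) : ℝ) : ℂ)

/-- `λ̄(−s, λ') = λ̄(s, λ)`. -/
theorem lambdaBar_lamFlip (a Λ s : ℝ) (ω : ℂ) (m : ℝ) (lam : ℂ) :
    lambdaBar a Λ (-s) ω m (lamFlip a Λ s lam) = lambdaBar a Λ s ω m lam := by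
  unfold lambdaBar lamFlip
  push_cast
  ring

/-! ### The five named analytic statements -/

/-- **K_A — Transfer** (CTdC Lemma 3.5 at the level of SOLUTIONS; ≈ 400–500 lines; exact CAS
check of the coefficient identity: pub-kds kit j165967). Every classical solution of the radial
Teukolsky equation on `(r₊, r_c)` that is ingoing at `𝓗⁺` and outgoing at `𝓗⁺_c` (generic bullets)
yields, under `u = Δ^{(s+1)/2}R`, `y = u/(r−r₃)`, `z = z_∞(r−r₀)/(r−r₃)` and the Euler gauge
`v = z^{−γ/2}(z−1)^{−δ/2}(z−z₂)^{−ε/2}·y`, Euler-gauge Heun mode data on `(1,z₂)` with the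
parameters of the masses `(m₁,m₂,m₃,m₄)` and branch exponent `2η₁ − s` at `z = 1`, such that
`v ≡ 0 ⇒ R ≡ 0`; and `1 < z₂`. Route: twin of `KerrDeSitterHeunEquivalence` (LIT-1) under CTdC's
Möbius map, `KerrDeSitterHiddenSymmetryKernel.sqcdCoeff_eq_normalForm`, `branch_event/branch_cosmo`. -/
def Transfer : Prop :=
  ∀ (M a Λ s : ℝ) (ω : ℂ) (m : ℝ) (lam : ℂ) (R : ℝ → ℂ), IsSubextremal M a Λ →
    IsRadialTeukolskySolution M a Λ s ω m lam R → IsIngoingAtEventHorizon M a Λ s ω m R →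
    IsOutgoingAtCosmoHorizon M a Λ ω m R →
      1 < zTwo M a Λ ∧
      ∃ v : ℝ → ℂ,
        HeunModeData (zTwo M a Λ)
          (eulerGaugeα (mass₂ M a Λ ω m) (mass₃ M a Λ s ω m))
          (eulerGaugeβ (mass₂ M a Λ ω m) (mass₄ M a Λ ω m))
          (eulerGaugeγ (mass₁ M a Λ s ω m) (mass₂ M a Λ ω m))
          (eulerGaugeδ (mass₁ M a Λ s ω m) (mass₂ M a Λ ω m))
          (eulerGaugeε (mass₃ M a Λ s ω m) (mass₄ M a Λ ω m))
          (eulerGaugeQ (mass₁ M a Λ s ω m) (mass₂ M a Λ ω m) (mass₃ M a Λ s ω m) (mass₄ M a Λ ω m)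
            (bigE M a Λ s ω m lam) (zTwo M a Λ : ℂ))
          (2 * etaEvent M a Λ ω m - (s : ℂ)) v ∧
        ((∀ w ∈ Ioo 1 (zTwo M a Λ), v w = 0) →
          ∀ r ∈ Ioo (rPlus M a Λ) (rCosmo M a Λ), R r = 0)

/-- **K_B — the one-sided Euler / Riemann–Liouville transform for Heun's equation** (general
statement of real analysis; ≈ 800–1200 lines; algebraic core LANDED: `GeneralHeun.euler_kernel_identity`,
`GeneralHeun.euler_tau_identity`). For a Heun equation on `(1,z₂)` (`a_H = z₂ > 1`, Fuchs
relation) and a source exponent `η ∈ {α, β}`, every Euler-gauge mode datum `v` with branch exponent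
`ρ = 1 − δ` at `1`, `Re ρ > −1`, has an image `u` — the (derivative-regularised) transform
`u(z) = ∂_z^k ∫₀¹ (z−1)^{k+η−1}(1−t)^{k+η−2} v(1+(z−1)t) dt`, `k = max(0, ⌈Re(2−η)⌉)` (kernel
`(z−w)^{η−2}`) — which is Euler-gauge mode data for Takemura's image parameters
(`eulerSrc · η`, `eulerSrcα η`, `eulerSrcβ α β η`, `eulerSrcQ`) with branch exponent `ρ + η − 1` at
`1` (Beta integral on the leading Frobenius term) and the analytic branch at `z₂`, and `u ≡ 0 ⇒ v ≡ 0`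
(injectivity of Riemann–Liouville operators). Boundary terms vanish exactly under `Re ρ > −1` and
the regularisation order (pub-kds kit j166563, w3-tau-reg). -/
def EulerRL : Prop :=
  ∀ (z₂ : ℝ) (α β γ δ ε q η ρ : ℂ) (v : ℝ → ℂ), 1 < z₂ → γ + δ + ε = α + β + 1 →
    (η - α) * (η - β) = 0 → ρ = 1 - δ → -1 < ρ.re → HeunModeData z₂ α β γ δ ε q ρ v →
      ∃ u : ℝ → ℂ,
        HeunModeData z₂ (eulerSrcα η) (eulerSrcβ α β η) (eulerSrc γ η) (eulerSrc δ η)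
          (eulerSrc ε η) (eulerSrcQ (z₂ : ℂ) γ δ ε q η) (ρ + η - 1) u ∧
        ((∀ z ∈ Ioo 1 z₂, u z = 0) → ∀ w ∈ Ioo 1 z₂, v w = 0)

/-- **K_G — gauge glue** (general masses; ≈ 200–300 lines): Euler-gauge Heun mode data for masses
`(m₁,m₂,m₃,m₄)` gives, under `R = z^{γ/2}(z−1)^{δ/2}(z₂−z)^{ε/2}·u` (positive real bases on
`(1,z₂)`), normal-form mode data for CTdC's (3.11) coefficient `sqcdCoeff m₁ m₂ m₃ m₄ E z₂` with
exponents `ρ + δ/2` at `1` and `ε/2` at `z₂`, and `R ≡ 0 ⇒ u ≡ 0`. Route: product rule +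
`sqcdCoeff_eq_normalForm`. -/
def GaugeGlue : Prop :=
  ∀ (z₂ : ℝ) (m₁ m₂ m₃ m₄ E ρ : ℂ) (u : ℝ → ℂ), 1 < z₂ →
    HeunModeData z₂ (eulerGaugeα m₂ m₃) (eulerGaugeβ m₂ m₄) (eulerGaugeγ m₁ m₂)
        (eulerGaugeδ m₁ m₂) (eulerGaugeε m₃ m₄) (eulerGaugeQ m₁ m₂ m₃ m₄ E (z₂ : ℂ)) ρ u →
      ∃ R : ℝ → ℂ,
        NormalFormModeData z₂ (fun z => sqcdCoeff m₁ m₂ m₃ m₄ E (z₂ : ℂ) z)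
          (ρ + eulerGaugeδ m₁ m₂ / 2) (eulerGaugeε m₃ m₄ / 2) R ∧
        ((∀ z ∈ Ioo 1 z₂, R z = 0) → ∀ z ∈ Ioo 1 z₂, u z = 0)

/-- **K₂ — CTdC Theorem 3.10, proof Step 2, as a statement** (LIT-1's file
`KerrDeSitterHiddenSymmetryEnergy.lean`, ≈ 700–900 lines): for subextremal `(M,a,Λ)`, `0 ≤ a`,
`Im ω > 0`, `Im(λ̄ ω̄) ≤ 0` and `|ω| ∉ |m|·(0, Ω_SR)`, every normal-form mode datum of the SWAPPED
equation (3.25) — coefficient `tildeCoeff`, exponents `½ + η₀ + η₁` at `1` and `½ − η₀ − η₂` at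
`z₂`, i.e. (3.26) — vanishes identically on `(1,z₂)` (energy identity (3.28) for
`ũ = [z(z−1)(z₂−z)]^{−1/2}R̃` with the potential (3.27), positivity (3.29)). -/
def SwappedEnergyVanishing : Prop :=
  ∀ (M a Λ s : ℝ) (ω : ℂ) (m : ℝ) (lam : ℂ) (Rt : ℝ → ℂ), IsSubextremal M a Λ → 0 ≤ a →
    0 < ω.im → (lambdaBar a Λ s ω m lam * (starRingEnd ℂ) ω).im ≤ 0 →
    ¬(0 < ‖ω‖ ∧ ‖ω‖ < |m| * superradiantUpper M a Λ) →
    NormalFormModeData (zTwo M a Λ) (tildeCoeff M a Λ s ω m lam)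
        (1 / 2 + etaCauchy M a Λ ω m + etaEvent M a Λ ω m)
        (1 / 2 - etaCauchy M a Λ ω m - etaCosmo M a Λ ω m) Rt →
      ∀ z ∈ Ioo 1 (zTwo M a Λ), Rt z = 0

/-- **K_C — spin flip for `s ≥ 1`** (Teukolsky–Starobinsky / Umetsu `|2s|`-th derivative, =
CTdC's (i)⇔(ii), the Euler kernel with INTEGER exponent `1−2s`; ≈ 300–400 lines on top of the landed
`HeunDerivative`; needed only because the event-horizon branch `2η₁ − s` is integrable iff
`Im ω > (s−1)κ₁`): a generic-boundary radial solution of spin `s ≥ 1` yields one of spin `−s` with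
separation constant `λ' = λ − 2s(1−α)` (same `λ̄`), generic boundary bullets, and `R' ≡ 0 ⇒ R ≡ 0`. -/
def SpinFlip : Prop :=
  ∀ (M a Λ s : ℝ) (ω : ℂ) (m : ℝ) (lam : ℂ) (R : ℝ → ℂ), IsSubextremal M a Λ → 1 ≤ s →
    (∃ k : ℤ, 2 * s = k) → 0 < ω.im →
    IsRadialTeukolskySolution M a Λ s ω m lam R → IsIngoingAtEventHorizon M a Λ s ω m R →
    IsOutgoingAtCosmoHorizon M a Λ ω m R →
      ∃ R' : ℝ → ℂ, IsRadialTeukolskySolution M a Λ (-s) ω m (lamFlip a Λ s lam) R' ∧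
        IsIngoingAtEventHorizon M a Λ (-s) ω m R' ∧ IsOutgoingAtCosmoHorizon M a Λ ω m R' ∧
        ((∀ r ∈ Ioo (rPlus M a Λ) (rCosmo M a Λ), R' r = 0) →
          ∀ r ∈ Ioo (rPlus M a Λ) (rCosmo M a Λ), R r = 0)

/-! ### Parameter identities used by the assembly -/

/-- `δ̃ = 1 + m₁ + m₃ = 1 − 2η₁ − 2η₀` for the swapped masses. -/
theorem eulerGaugeδ_swap_eta (s η₀ η₁ : ℂ) :
    eulerGaugeδ (sqcdM₁ s η₀ η₁) (sqcdM₃ s η₀ η₁) = 1 - 2 * η₁ - 2 * η₀ := by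
  unfold eulerGaugeδ sqcdM₁ sqcdM₃; ring

/-- `ε̃ = 1 − m₂ − m₄ = 1 − 2η₀ − 2η₂` for the swapped masses. -/
theorem eulerGaugeε_swap_eta (η₀ η₁ η₂ : ℂ) :
    eulerGaugeε (sqcdM₂ η₀ η₁) (sqcdM₄ η₀ η₁ η₂) = 1 - 2 * η₀ - 2 * η₂ := by
  unfold eulerGaugeε sqcdM₂ sqcdM₄; ring

/-! ### The assembly -/

/-- **Route W for spins `s < 1`** (covers the cell's `s = −2` and `s = 0`): `Transfer`, `EulerRL`,
`GaugeGlue` and `SwappedEnergyVanishing` imply that every generic-boundary radial mode with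
`Im ω > 0`, `Im(λ̄ω̄) ≤ 0`, `|ω| ∉ |m|(0,Ω_SR)` vanishes. PROVED (the composition is kernel-checked). -/
theorem radial_vanishing_of_routeW_lt_one (kA : Transfer) (kB : EulerRL) (kG : GaugeGlue)
    (k2 : SwappedEnergyVanishing) {M a Λ s : ℝ} {ω : ℂ} {m : ℝ} {lam : ℂ} {R : ℝ → ℂ}
    (hsub : IsSubextremal M a Λ) (ha : 0 ≤ a) (hs : s < 1) (hω : 0 < ω.im)
    (hlam : (lambdaBar a Λ s ω m lam * (starRingEnd ℂ) ω).im ≤ 0)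
    (hSR : ¬(0 < ‖ω‖ ∧ ‖ω‖ < |m| * superradiantUpper M a Λ))
    (hR : IsRadialTeukolskySolution M a Λ s ω m lam R) (hin : IsIngoingAtEventHorizon M a Λ s ω m R)
    (hout : IsOutgoingAtCosmoHorizon M a Λ ω m R) :
    ∀ r ∈ Ioo (rPlus M a Λ) (rCosmo M a Λ), R r = 0 := by
  obtain ⟨hz₂, v, hv, hvR⟩ := kA M a Λ s ω m lam R hsub hR hin hout
  -- abbreviations
  set η₀ := etaCauchy M a Λ ω m with hη₀
  set η₁ := etaEvent M a Λ ω m with hη₁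
  set η₂ := etaCosmo M a Λ ω m with hη₂
  set z₂ := zTwo M a Λ with hz₂def
  -- the Euler step: source exponent η = α = 1 + s + 2η₀
  have hF := eulerGauge_fuchs (mass₁ M a Λ s ω m) (mass₂ M a Λ ω m) (mass₃ M a Λ s ω m)
    (mass₄ M a Λ ω m)
  have hroot := euler_exponent_root (mass₂ M a Λ ω m) (mass₃ M a Λ s ω m) (mass₄ M a Λ ω m)
  have hρ : 2 * etaEvent M a Λ ω m - (s : ℂ) =
      1 - eulerGaugeδ (mass₁ M a Λ s ω m) (mass₂ M a Λ ω m) := by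
    unfold mass₁ mass₂
    rw [eulerGaugeδ_eta]
    ring
  have hκ₁ := surfaceGravity_rPlus_pos hsub
  have hre : -1 < (2 * etaEvent M a Λ ω m - (s : ℂ)).re := by
    have h1 : (2 * etaEvent M a Λ ω m - (s : ℂ)).re = 2 * (etaEvent M a Λ ω m).re - s := by
      simp [Complex.mul_re]
    rw [h1, etaEvent_re]
    have h2 : 0 < ω.im / (2 * surfaceGravity M a Λ (rPlus M a Λ)) :=
      div_pos hω (mul_pos two_pos hκ₁)
    linarith
  obtain ⟨u, hu, huv⟩ := kB z₂ _ _ _ _ _ _ _ _ v hz₂ hF hroot hρ hre hv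
  rw [euler_swap_α, euler_swap_β, euler_swap_γ, euler_swap_δ, euler_swap_ε, euler_swap_q] at hu
  -- gauge glue with the swapped masses (m₁, m₃, m₂, m₄)
  obtain ⟨Rt, hRt, hRtu⟩ := kG z₂ (mass₁ M a Λ s ω m) (mass₃ M a Λ s ω m) (mass₂ M a Λ ω m)
    (mass₄ M a Λ ω m) (bigE M a Λ s ω m lam) _ u hz₂ hu
  -- exponents of (3.26)
  have he₁ : 2 * etaEvent M a Λ ω m - (s : ℂ) + eulerGaugeα (mass₂ M a Λ ω m) (mass₃ M a Λ s ω m)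
        - 1 + eulerGaugeδ (mass₁ M a Λ s ω m) (mass₃ M a Λ s ω m) / 2 =
      1 / 2 + etaCauchy M a Λ ω m + etaEvent M a Λ ω m := by
    unfold mass₁ mass₂ mass₃
    rw [eulerGaugeα_eta, eulerGaugeδ_swap_eta]
    ring
  have he₂ : eulerGaugeε (mass₂ M a Λ ω m) (mass₄ M a Λ ω m) / 2 =
      1 / 2 - etaCauchy M a Λ ω m - etaCosmo M a Λ ω m := by
    unfold mass₂ mass₄
    rw [eulerGaugeε_swap_eta]
    ring
  rw [he₁, he₂] at hRt
  -- the coefficient of (3.25) = (3.11) with m₂ ↔ m₃ on (1, z₂)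
  have hsub' := hsub
  obtain ⟨hM, hΛ, h01, h12, -⟩ := hsub'
  have hr₀ : 0 ≤ rMinus M a Λ := rMinus_nonneg M a Λ
  have hcoef : ∀ z ∈ Ioo 1 z₂,
      sqcdCoeff (mass₁ M a Λ s ω m) (mass₃ M a Λ s ω m) (mass₂ M a Λ ω m) (mass₄ M a Λ ω m)
          (bigE M a Λ s ω m lam) (z₂ : ℂ) z = tildeCoeff M a Λ s ω m lam z := by
    intro z hz
    obtain ⟨hz1, hzz⟩ := hz
    unfold tildeCoeff bigE mass₁ mass₂ mass₃ mass₄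
    rw [hz₂def] at hzz ⊢
    unfold zTwo
    symm
    refine ctdcTilde_eq_sqcd_swap (s : ℂ) η₀ η₁ η₂ (ltBlock M a Λ s ω m lam) ?_ ?_ ?_ ?_ ?_ ?_ ?_
    · exact_mod_cast (sub_pos.mpr h01).ne'
    · have : 0 < rCosmo M a Λ + (rMinus M a Λ + rPlus M a Λ + rCosmo M a Λ) := by linarith
      exact_mod_cast this.ne'
    · have : 0 < rPlus M a Λ + rCosmo M a Λ := by linarith
      exact_mod_cast this.ne'
    · have : (0 : ℝ) < z := by linarith
      exact_mod_cast this.ne'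
    · exact sub_ne_zero.mpr (by exact_mod_cast (ne_of_gt hz1))
    · unfold zTwo at hzz
      exact sub_ne_zero.mpr (by exact_mod_cast (ne_of_gt hzz))
    · rw [hz₂def] at hz₂
      unfold zTwo at hz₂
      have : (0 : ℝ) < ctdcZ₂ (rMinus M a Λ) (rPlus M a Λ) (rCosmo M a Λ) := by linarith
      exact_mod_cast this.ne'
  have hRt' : NormalFormModeData z₂ (tildeCoeff M a Λ s ω m lam)
      (1 / 2 + etaCauchy M a Λ ω m + etaEvent M a Λ ω m)
      (1 / 2 - etaCauchy M a Λ ω m - etaCosmo M a Λ ω m) Rt := hRt.congr hcoef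
  -- energy identity on the swapped problem, then back through the injectivities
  have hRt0 := k2 M a Λ s ω m lam Rt hsub ha hω hlam hSR hRt'
  exact hvR (huv (hRtu hRt0))

/-- **Route W, full spin range.** With `SpinFlip` for `s ≥ 1` (where the event-horizon branch
`2η₁ − s` of the spin-`s` problem need not be integrable), the four statements above imply the
conclusion for every `s` with `2s ∈ ℤ`. PROVED. -/
theorem radial_vanishing_of_routeW (kA : Transfer) (kB : EulerRL) (kG : GaugeGlue)
    (k2 : SwappedEnergyVanishing) (kC : SpinFlip) {M a Λ s : ℝ} {ω : ℂ} {m : ℝ} {lam : ℂ}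
    {R : ℝ → ℂ} (hsub : IsSubextremal M a Λ) (ha : 0 ≤ a) (h2s : ∃ k : ℤ, 2 * s = k)
    (hω : 0 < ω.im) (hlam : (lambdaBar a Λ s ω m lam * (starRingEnd ℂ) ω).im ≤ 0)
    (hSR : ¬(0 < ‖ω‖ ∧ ‖ω‖ < |m| * superradiantUpper M a Λ))
    (hR : IsRadialTeukolskySolution M a Λ s ω m lam R) (hin : IsIngoingAtEventHorizon M a Λ s ω m R)
    (hout : IsOutgoingAtCosmoHorizon M a Λ ω m R) :
    ∀ r ∈ Ioo (rPlus M a Λ) (rCosmo M a Λ), R r = 0 := by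
  by_cases hs : s < 1
  · exact radial_vanishing_of_routeW_lt_one kA kB kG k2 hsub ha hs hω hlam hSR hR hin hout
  · have hs1 : 1 ≤ s := not_lt.mp hs
    obtain ⟨R', hR', hin', hout', hback⟩ := kC M a Λ s ω m lam R hsub hs1 h2s hω hR hin hout
    have hs' : -s < 1 := by linarith
    have hlam' : (lambdaBar a Λ (-s) ω m (lamFlip a Λ s lam) * (starRingEnd ℂ) ω).im ≤ 0 := by
      rw [lambdaBar_lamFlip]; exact hlam
    exact hback (radial_vanishing_of_routeW_lt_one kA kB kG k2 hsub ha hs' hω hlam' hSR hR' hin' hout')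

/-- **ROUTE W REDUCES H3.** The five named statements imply the cell's cited fact
`CasalsTeixeiraDaCosta2022_partialModeStabilityProp38` VERBATIM (its Proposition-3.8 side
conditions — `Σ m_j ∉ ℤ_{≥2}`, the four pair conditions — are not even used: route W needs only
`Re(2η₁ − s) > −1`, automatic for `Im ω > 0`, `s < 1`, and restored by `SpinFlip` otherwise).
PROVED; the five hypotheses are this venture's Monday decision object. -/
theorem prop38_of_routeW (kA : Transfer) (kB : EulerRL) (kG : GaugeGlue)
    (k2 : SwappedEnergyVanishing) (kC : SpinFlip) :
    CasalsTeixeiraDaCosta2022_partialModeStabilityProp38 := by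
  intro M a Λ s ω m lam hsub ha _ h2s _ hω hlam hSR _ _ _ _ _ R hR hin hout
  exact radial_vanishing_of_routeW kA kB kG k2 kC hsub ha h2s hω hlam hSR hR hin hout

end RouteW

end Summit.Ventures.KdS
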